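import Literature.AlgebraicGeometry.Resolution.NormalCrossingsLocal
import Literature.AlgebraicGeometry.Resolution.StrictNormalCrossingsDescent
import Literature.AlgebraicGeometry.Resolution.RegularQuotientIdeal
import HarnessLib

/-!
# The local strict normal crossings condition at a point

Topic: `Literature/AlgebraicGeometry/Resolution`. The pointwise content of de Jong 1996, 2.4 /
Stacks 0BI9 (`IsStrictNormalCrossingsDivisor`, local form): at a point `p` of the closed subset
`Z ⊆ X`, the local ring `A = 𝒪_{X,p}` is regular and the ideal `I = I(Z)_p` of germs vanishing
on `Z` is `(x₁ ⋯ x_r)` for a regular system of parameters `x₁, …, x_r, y₁, …, y_e` of `A`,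
`r ≥ 1`. This file isolates that condition as a predicate on a pair (local ring, ideal),
`IsSNCIdeal I`, and on a triple (scheme, closed subset, point), `IsStrictNormalCrossingsAt X Z p`,
so that openness / spreading statements about strict normal crossings divisors can be phrased
(`StrictNormalCrossingsOpen.lean`, for the formal-to-étale bridge of de Jong 1996, 4.25/4.28),
and PROVES its basic algebra:

* `isStrictNormalCrossingsDivisor_iff_forall_isStrictNormalCrossingsAt` — the divisor condition
  is the pointwise condition at all points of the closed set;
* `IsSNCIdeal.of_ringEquiv`, `IsStrictNormalCrossingsAt.iff_of_isOpenImmersion` — transport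
  along ring isomorphisms / open immersions;
* `linearIndependent_toCotangent_iff_forall_mem` — "the differentials `dxᵢ ∈ 𝔪/𝔪²` are
  linearly independent" iff "`∑ cᵢ xᵢ ∈ 𝔪²` forces all `cᵢ ∈ 𝔪`";
  `IsSNCIdeal.of_linearIndependent` / `IsSNCIdeal.exists_linearIndependent` — the condition in
  terms of elements `x₁, …, x_r ∈ 𝔪` with linearly independent differentials and
  `I = (x₁ ⋯ x_r)` (extension to a regular system of parameters, Matsumura 14.2);
* `linearIndependent_toCotangent_of_isRegularLocalRing_quotient` — the key to spreading: in a
  regular local ring `B`, elements `z₁, …, z_t ∈ 𝔪` none of which lies in the ideal of the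
  others and such that `B/(z₁, …, z_t)` is regular have linearly independent differentials
  (Matsumura 14.2: the ideal of a regular quotient is generated by a sub-family of any
  generating set with independent differentials; minimality forces the sub-family to be all
  of `z`).

## Sources

* A. J. de Jong, *Smoothness, semi-stability and alterations*, Publ. Math. IHÉS 83 (1996), 2.4.
* H. Matsumura, *Commutative Ring Theory* (1986), Thm. 14.2.
* The Stacks Project, Tag 0BI9.
-/

noncomputable section

open CategoryTheory AlgebraicGeometry TopologicalSpace IsLocalRing

universe u

namespace Literature.AlgebraicGeometry.Resolution

open Scheme.IdealSheafData

/-! ## The predicate on a local ring with an ideal -/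

/-- **Local strict normal crossings data** for an ideal `I` of a local ring `A` (de Jong 1996,
2.4 / Stacks 0BI9 at one point): `A` is a regular local ring and there is a regular system of
parameters `x₁, …, x_r, y₁, …, y_e` of `A` (`r + e = dim A` generators of `𝔪_A`) with `r ≥ 1`
and `I = (x₁ ⋯ x_r)`. [cite: StacksProject, Tag 0BI9] -/
def IsSNCIdeal {A : Type u} [CommRing A] [IsLocalRing A] (I : Ideal A) : Prop :=
  IsRegularLocalRing A ∧
    ∃ (r e : ℕ) (x : Fin r → A) (y : Fin e → A), 1 ≤ r ∧ ringKrullDim A = (r + e : ℕ) ∧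
      Ideal.span (Set.range x ∪ Set.range y) = maximalIdeal A ∧ I = Ideal.span {∏ i, x i}

/-- **The strict normal crossings condition at a point**: for a subset `Z` of a scheme `X` and
a point `p`, the ideal `I(Z)_p ⊆ 𝒪_{X,p}` of germs vanishing on (the closure of) `Z`
(`stalkIdeal` of the vanishing ideal sheaf) has local strict normal crossings data
(`IsSNCIdeal`). [cite: StacksProject, Tag 0BI9] -/
def IsStrictNormalCrossingsAt (X : Scheme.{u}) (Z : Set X) (p : X) : Prop :=
  IsSNCIdeal (stalkIdeal (vanishingIdeal ⟨closure Z, isClosed_closure⟩) p)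

/-- A strict normal crossings divisor is a closed subset satisfying the strict normal crossings
condition at each of its points. [cite: DeJong1996, 2.4, p. 55] -/
theorem isStrictNormalCrossingsDivisor_iff_forall_isStrictNormalCrossingsAt (X : Scheme.{u})
    (Z : Set X) :
    IsStrictNormalCrossingsDivisor X Z ↔ IsClosed Z ∧ ∀ p ∈ Z, IsStrictNormalCrossingsAt X Z p :=
  isStrictNormalCrossingsDivisor_iff_stalkIdeal X Z

/-- The pointwise conditions on a closed subset give a strict normal crossings divisor.
[folklore] -/
theorem IsStrictNormalCrossingsDivisor.of_forall_isStrictNormalCrossingsAt {X : Scheme.{u}}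
    {Z : Set X} (hZ : IsClosed Z) (h : ∀ p ∈ Z, IsStrictNormalCrossingsAt X Z p) :
    IsStrictNormalCrossingsDivisor X Z :=
  (isStrictNormalCrossingsDivisor_iff_forall_isStrictNormalCrossingsAt X Z).mpr ⟨hZ, h⟩

/-- A strict normal crossings divisor satisfies the condition at each of its points.
[folklore] -/
theorem IsStrictNormalCrossingsDivisor.isStrictNormalCrossingsAt {X : Scheme.{u}} {Z : Set X}
    (h : IsStrictNormalCrossingsDivisor X Z) {p : X} (hp : p ∈ Z) :
    IsStrictNormalCrossingsAt X Z p :=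
  ((isStrictNormalCrossingsDivisor_iff_forall_isStrictNormalCrossingsAt X Z).mp h).2 p hp

namespace IsSNCIdeal

variable {A B : Type u} [CommRing A] [IsLocalRing A] [CommRing B] [IsLocalRing B]

/-- The local ring carrying local strict normal crossings data is regular. [folklore] -/
theorem isRegularLocalRing {I : Ideal A} (h : IsSNCIdeal I) : IsRegularLocalRing A :=
  h.1

/-- An ideal with local strict normal crossings data is proper (`⊆ 𝔪`). [folklore] -/
theorem le_maximalIdeal {I : Ideal A} (h : IsSNCIdeal I) : I ≤ maximalIdeal A := by
  obtain ⟨-, r, e, x, y, hr, -, hspan, rfl⟩ := h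
  rw [Ideal.span_singleton_le_iff_mem]
  haveI : Nonempty (Fin r) := ⟨⟨0, hr⟩⟩
  obtain ⟨i⟩ := ‹Nonempty (Fin r)›
  have hxi : x i ∈ maximalIdeal A := hspan ▸ Ideal.subset_span (Or.inl ⟨i, rfl⟩)
  obtain ⟨c, hc⟩ : x i ∣ ∏ j, x j := Finset.dvd_prod_of_mem x (Finset.mem_univ i)
  rw [hc]
  exact Ideal.mul_mem_right _ _ hxi

/-- **Transport along a ring isomorphism.** [folklore] -/
theorem of_ringEquiv (e : A ≃+* B) {I : Ideal A} (h : IsSNCIdeal I) :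
    IsSNCIdeal (I.map (e : A →+* B)) := by
  obtain ⟨hreg, r, n, x, y, hr, hdim, hspan, rfl⟩ := h
  haveI := hreg
  refine ⟨IsRegularLocalRing.of_ringEquiv e, r, n, e ∘ x, e ∘ y, hr, ?_, ?_, ?_⟩
  · rw [← ringKrullDim_eq_of_ringEquiv e, hdim]
  · have := congrArg (Ideal.map (e : A →+* B)) hspan
    rw [Ideal.map_span, Set.image_union, ← Set.range_comp, ← Set.range_comp] at this
    rw [RingHom.coe_coe] at this
    rw [this]
    exact IsLocalRing.eq_maximalIdeal (Ideal.map_isMaximal_of_equiv e (p := maximalIdeal A))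
  · rw [Ideal.map_span, Set.image_singleton, map_prod]
    rfl

/-- Transport back and forth along an isomorphism. [folklore] -/
theorem iff_of_ringEquiv (e : A ≃+* B) (I : Ideal A) :
    IsSNCIdeal I ↔ IsSNCIdeal (I.map (e : A →+* B)) := by
  refine ⟨of_ringEquiv e, fun h => ?_⟩
  have := of_ringEquiv e.symm h
  rwa [Ideal.map_of_equiv] at this

end IsSNCIdeal

/-! ## Linear independence of differentials -/

section Cotangent

variable {A : Type u} [CommRing A] [IsLocalRing A]

/-- For elements `x₁, …, x_r ∈ 𝔪` of a local ring: the images `dxᵢ ∈ 𝔪/𝔪²` are linearly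
independent over the residue field iff every relation `∑ cᵢ xᵢ ∈ 𝔪²` has all its
coefficients in `𝔪`. [folklore] -/
theorem linearIndependent_toCotangent_iff_forall_mem {ι : Type*} [Fintype ι] (x : ι → A)
    (hx : ∀ i, x i ∈ maximalIdeal A) :
    LinearIndependent (ResidueField A) (fun i => (maximalIdeal A).toCotangent ⟨x i, hx i⟩) ↔
      ∀ c : ι → A, ∑ i, c i * x i ∈ (maximalIdeal A) ^ 2 → ∀ i, c i ∈ maximalIdeal A := by
  classical
  have key : ∀ c : ι → A,
      (maximalIdeal A).toCotangent (∑ i, c i • (⟨x i, hx i⟩ : maximalIdeal A)) =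
        ∑ i, (Ideal.Quotient.mk (maximalIdeal A) (c i)) •
          (maximalIdeal A).toCotangent ⟨x i, hx i⟩ := by
    intro c
    rw [map_sum]
    refine Finset.sum_congr rfl fun i _ => ?_
    rw [LinearMap.map_smul_of_tower]
    rfl
  have hcoe : ∀ c : ι → A,
      ((∑ i, c i • (⟨x i, hx i⟩ : maximalIdeal A) : maximalIdeal A) : A) = ∑ i, c i * x i := by
    intro c
    simp [smul_eq_mul]
  constructor
  · intro hli c hc i
    rw [Fintype.linearIndependent_iff] at hli
    have h0 : ∑ i, (Ideal.Quotient.mk (maximalIdeal A) (c i)) •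
        (maximalIdeal A).toCotangent ⟨x i, hx i⟩ = 0 := by
      rw [← key, Ideal.toCotangent_eq_zero, hcoe]
      exact hc
    exact Ideal.Quotient.eq_zero_iff_mem.mp (hli _ h0 i)
  · intro hind
    rw [Fintype.linearIndependent_iff]
    intro g hg i
    choose c hc using fun i => Ideal.Quotient.mk_surjective (g i)
    have hsum : (maximalIdeal A).toCotangent (∑ i, c i • (⟨x i, hx i⟩ : maximalIdeal A)) = 0 := by
      rw [map_sum, ← hg]
      refine Finset.sum_congr rfl fun i _ => ?_
      rw [LinearMap.map_smul_of_tower, ← hc i]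
      rfl
    have hmem : ∑ i, c i * x i ∈ (maximalIdeal A) ^ 2 := by
      rw [← hcoe, ← Ideal.toCotangent_eq_zero]
      exact hsum
    rw [← hc i]
    exact Ideal.Quotient.eq_zero_iff_mem.mpr (hind c hmem i)

end Cotangent

namespace IsSNCIdeal

variable {A : Type u} [CommRing A]

/-- **Local strict normal crossings data from elements with independent differentials**: in
a regular local ring `A`, if `x₁, …, x_r ∈ 𝔪` (`r ≥ 1`) have linearly independent images in
`𝔪/𝔪²`, then `(x₁ ⋯ x_r)` has local strict normal crossings data (extend `x` to a regular
system of parameters). [folklore] -/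
theorem of_linearIndependent [IsRegularLocalRing A] {r : ℕ} (hr : 1 ≤ r) (x : Fin r → A)
    (hx : ∀ i, x i ∈ maximalIdeal A)
    (hli : LinearIndependent (ResidueField A) fun i => (maximalIdeal A).toCotangent ⟨x i, hx i⟩)
    {I : Ideal A} (hI : I = Ideal.span {∏ i, x i}) : IsSNCIdeal I := by
  have hind := (linearIndependent_toCotangent_iff_forall_mem x hx).mp hli
  obtain ⟨e, y, hdim, hspan⟩ := exists_extend_to_rsop x hx hind
  exact ⟨‹_›, r, e, x, y, hr, hdim, hspan, hI⟩

/-- **Elements with independent differentials from local strict normal crossings data**: the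
`x`-part of the regular system of parameters. [folklore] -/
theorem exists_linearIndependent [IsLocalRing A] {I : Ideal A} (h : IsSNCIdeal I) :
    ∃ (r : ℕ) (x : Fin r → A) (hx : ∀ i, x i ∈ maximalIdeal A), 1 ≤ r ∧
      @LinearIndependent _ (ResidueField A) _
        (fun i => (maximalIdeal A).toCotangent ⟨x i, hx i⟩) _ _ _ ∧
      I = Ideal.span {∏ i, x i} := by
  obtain ⟨hreg, r, e, x, y, hr, hdim, hspan, hI⟩ := h
  haveI := hreg
  have hx : ∀ i, x i ∈ maximalIdeal A := fun i => hspan ▸ Ideal.subset_span (Or.inl ⟨i, rfl⟩)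
  refine ⟨r, x, hx, hr, ?_, hI⟩
  rw [linearIndependent_toCotangent_iff_forall_mem x hx]
  intro c hc i
  refine mem_maximalIdeal_of_sum_mul_mem_sq_of_rsop x y hdim hspan c 0 ?_ i
  simpa using hc

end IsSNCIdeal

/-! ## Matsumura 14.2, minimal form: regular quotient and minimality give independence -/

section Regular

variable {B : Type u} [CommRing B] [IsRegularLocalRing B]

/-- **Independence of differentials from a regular quotient** (Matsumura, Thm. 14.2): in a
regular local ring `B`, let `z₁, …, z_t ∈ 𝔪` be such that no `zᵢ` lies in the ideal generated
by the others and `B/(z₁, …, z_t)` is a regular local ring. Then `dz₁, …, dz_t ∈ 𝔪/𝔪²` are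
linearly independent (so `z` extends to a regular system of parameters). Indeed by Thm. 14.2
the ideal `(z)` is generated by a sub-family of `z` with independent differentials
(`exists_span_eq_of_isRegularLocalRing_quotient`), and minimality forces the sub-family to be
all of `z`. [cite: Matsumura1987, Thm. 14.2] -/
theorem linearIndependent_toCotangent_of_isRegularLocalRing_quotient {t : ℕ} (z : Fin t → B)
    (hz : ∀ i, z i ∈ maximalIdeal B)
    [IsRegularLocalRing (B ⧸ Ideal.span (Set.range z))]
    (hmin : ∀ i, z i ∉ Ideal.span (z '' {j | j ≠ i})) :
    LinearIndependent (ResidueField B) fun i => (maximalIdeal B).toCotangent ⟨z i, hz i⟩ := by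
  classical
  set J : Ideal B := Ideal.span (Set.range z) with hJ
  have hJm : J ≤ maximalIdeal B := Ideal.span_le.mpr (by
    rintro _ ⟨i, rfl⟩
    exact hz i)
  obtain ⟨c, f, hfG, hspan, hli⟩ :=
    exists_span_eq_of_isRegularLocalRing_quotient hJm (Set.range z) rfl
  -- every `z i` occurs among the `f j`
  have hsurj : ∀ i, ∃ j, f j = z i := by
    intro i
    by_contra h
    push Not at h
    apply hmin i
    have hsub : Set.range f ⊆ z '' {j | j ≠ i} := by
      rintro _ ⟨j, rfl⟩
      obtain ⟨i', hi'⟩ := hfG j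
      refine ⟨i', ?_, hi'⟩
      rintro rfl
      exact h j hi'.symm
    have : z i ∈ J := Ideal.subset_span ⟨i, rfl⟩
    rw [← hspan] at this
    exact Ideal.span_mono hsub this
  choose σ hσ using hsurj
  -- `z` is injective by minimality, hence so is `σ`
  have hzinj : Function.Injective z := by
    intro i i' h
    by_contra hne
    exact hmin i (Ideal.subset_span ⟨i', fun h' => hne h'.symm, h.symm⟩)
  have hσ_inj : Function.Injective σ := fun i i' h => hzinj (by rw [← hσ i, ← hσ i', h])
  have := hli.comp σ hσ_inj
  convert this using 1
  funext i
  simp only [Function.comp_apply]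
  congr 1
  exact Subtype.ext (hσ i).symm

/-- In the situation of `linearIndependent_toCotangent_of_isRegularLocalRing_quotient`, the
product `z₁ ⋯ z_t` (`t ≥ 1`) generates an ideal with local strict normal crossings data.
[cite: Matsumura1987, Thm. 14.2] -/
theorem IsSNCIdeal.of_isRegularLocalRing_quotient {t : ℕ} (ht : 1 ≤ t) (z : Fin t → B)
    (hz : ∀ i, z i ∈ maximalIdeal B) [IsRegularLocalRing (B ⧸ Ideal.span (Set.range z))]
    (hmin : ∀ i, z i ∉ Ideal.span (z '' {j | j ≠ i})) {I : Ideal B}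
    (hI : I = Ideal.span {∏ i, z i}) : IsSNCIdeal I :=
  IsSNCIdeal.of_linearIndependent ht z hz
    (linearIndependent_toCotangent_of_isRegularLocalRing_quotient z hz hmin) hI

end Regular

/-! ## Transport along open immersions -/

/-- **The pointwise condition is invariant under open immersions**: for an open immersion
`j : U → X`, a subset `Z ⊆ X` which is closed, and `y ∈ U`, the condition for `Z` at `j y`
is the condition for `j⁻¹ Z` at `y` (transport along `𝒪_{X,j y} ≅ 𝒪_{U,y}`, the ideal of `Z`
going to the ideal of `j⁻¹ Z`). [folklore] -/
theorem IsStrictNormalCrossingsAt.iff_of_isOpenImmersion {U X : Scheme.{u}} (j : U ⟶ X)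
    [IsOpenImmersion j] {Z : Set X} (hZ : IsClosed Z) (y : U) :
    IsStrictNormalCrossingsAt X Z (j y) ↔ IsStrictNormalCrossingsAt U (j ⁻¹' Z) y := by
  let φ : X.presheaf.stalk (j y) ≃+* U.presheaf.stalk y :=
    (asIso (j.stalkMap y)).commRingCatIsoToRingEquiv
  have hφ : (φ : X.presheaf.stalk (j y) →+* U.presheaf.stalk y) = (j.stalkMap y).hom := rfl
  have hcl : (⟨closure Z, isClosed_closure⟩ : Closeds X) = ⟨Z, hZ⟩ := Closeds.ext hZ.closure_eq
  have hcl' : (⟨closure (j ⁻¹' Z), isClosed_closure⟩ : Closeds U) =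
      (⟨Z, hZ⟩ : Closeds X).preimage j.continuous := by
    apply Closeds.ext
    simp only [Closeds.coe_mk, Closeds.coe_preimage]
    exact (hZ.preimage j.continuous).closure_eq
  unfold IsStrictNormalCrossingsAt
  rw [hcl', ← comap_vanishingIdeal_of_isOpenImmersion, stalkIdeal_comap_of_isOpenImmersion,
    hcl, ← hφ]
  exact IsSNCIdeal.iff_of_ringEquiv φ _

end Literature.AlgebraicGeometry.Resolution

end
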